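import Literature.Probability.LatticeModels.HighDimTrivialityPanisProofs
import Literature.Probability.LatticeModels.AizenmanWickBoundProofs
import Literature.Probability.LatticeModels.ImprovedTreeDiagramBoundSum
import Literature.Probability.LatticeModels.SlidingScaleInfraredBoundProofs
import HarnessLib

/-!
# High-dimensional triviality of Ising scaling limits, VII: crit-ising.S13 (printed regime) from ADC Theorems 1.3 and 5.6

Topic `Literature/Probability/LatticeModels`; family `crit-ising` (crit-ising.S13). Third proof
companion of `HighDimTriviality` (next to `HighDimTrivialityProofs`, which reduced the named fact
`isGaussianProcess_of_tendstoInDistribution_smearedSpin_printRegime` to three printed theorems —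
Aizenman 1982 Prop. 12.1 in finite volume, the `d = 4` bound on `∑ |U₄|` and the `d ≥ 5` bound on
`∑ |U₄|` — and `HighDimTrivialityPanisProofs`, which discharged Panis's Theorem 5.5).

Since then the tree has acquired

* `aizenman_wickDeviation_le_finite_holds` (`AizenmanWickBoundProofs`: Aizenman, Comm. Math. Phys.
  86 (1982), Prop. 12.1, PROVED through the random-walk representation of §9);
* `panis_mgf_normalizedField_bound_holds` (`HighDimTrivialityPanisProofs`: Panis 2023, Thm 5.5 for
  the nearest-neighbour model, `d ≥ 5`, PROVED);
* `aizenmanDuminilCopin_ursellFourSum_le_of_facts` (`ImprovedTreeDiagramBoundSum`: the §6.3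
  summation of Aizenman–Duminil-Copin 2021, PROVED from the paper's numbered Theorems 1.3 and 5.6),

so that the whole of crit-ising.S13 in the printed regime now rests on exactly **two** named facts,
both theorems of M. Aizenman, H. Duminil-Copin, *Marginal triviality of the scaling limits of
critical 4D Ising and `φ⁴₄` models*, Ann. of Math. 194 (2021) = arXiv:1912.07973:

* Theorem 1.3 (improved tree diagram bound, `d = 4`) — `aizenmanDuminilCopin_improvedTreeDiagramBound`;
* Theorem 5.6 (sliding-scale infrared bound, `d > 2`) — `aizenmanDuminilCopin_slidingScaleInfraredBound`

(both in `ImprovedTreeDiagramBound`). This file records that reduction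
(`isGaussianProcess_of_tendstoInDistribution_smearedSpin_printRegime_of_adc`): once the two theorems
are discharged, `isGaussianProcess_of_tendstoInDistribution_smearedSpin_printRegime_holds` is the
one-liner `…_of_adc T13_holds T56_holds`. **No definition and no named fact is introduced.**

**Update (Theorem 5.6 discharged).** Theorem 5.6 is now a theorem of the tree
(`aizenmanDuminilCopin_slidingScaleInfraredBound_holds`, `SlidingScaleInfraredBoundProofs`: ADC §5.2–5.3
through the transfer-matrix monotonicity of `Ŝ_β`, the Fejér-kernel two-scale comparison and the
left-continuity of the free state at `β_c`), so crit-ising.S13 in the printed regime rests on ADC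
**Theorem 1.3 alone**: `isGaussianProcess_of_tendstoInDistribution_smearedSpin_printRegime_of_improvedTreeDiagramBound`.
The discharge `isGaussianProcess_of_tendstoInDistribution_smearedSpin_printRegime_holds` is that theorem
applied to `aizenmanDuminilCopin_improvedTreeDiagramBound_holds` once Theorem 1.3 (ADC §4.1/§6.1: the
intersection-clustering bound Prop. 6.1 at regular scales, whose reduction to Thm 1.3 on finite graphs is
the tree's `ClusteringToTreeBound`) is proved; it is to be appended here.

**Update (Prop. 1.4 on Theorem 1.3 alone).** The same substitution for the exponential-moment
estimate itself: `aizenmanDuminilCopin_mgf_normalizedField_bound_abs_of_improvedTreeDiagramBound`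
derives the named fact `aizenmanDuminilCopin_mgf_normalizedField_bound_abs` (ADC Prop. 1.4 in the form
its proof establishes, `HighDimTrivialityMoments`) from `aizenmanDuminilCopin_improvedTreeDiagramBound`
(Thm 1.3) and nothing else, so that its discharge `aizenmanDuminilCopin_mgf_normalizedField_bound_abs_holds`
is that theorem applied to `aizenmanDuminilCopin_improvedTreeDiagramBound_holds`, to be appended here
when Theorem 1.3 is proved.

## References

* M. Aizenman, H. Duminil-Copin, Ann. of Math. 194 (2021) 163–235 = arXiv:1912.07973: Thm 1.2 and
  the Gaussianity argument on p. 6; Prop. 1.4; Thm 1.3 (p. 6); Thm 5.6 (p. 18); §6.3 (pp. 26–27)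
  [AizenmanDuminilCopinAnnals2021] (held; read).
* R. Panis, arXiv:2309.05797, Thm 5.5 [Panis2023Triviality]; M. Aizenman, Comm. Math. Phys. 86
  (1982), Prop. 12.1 [AizenmanCMP1982].
-/

noncomputable section

open MeasureTheory ProbabilityTheory Filter Topology
open Literature.Probability.LatticeModels Literature.Probability.Percolation

namespace Literature.Probability.LatticeModels

/-- **Aizenman–Duminil-Copin 2021, Prop. 1.4 (in the form its proof establishes) from Theorems 1.3
and 5.6 of the same paper.** Granted the improved tree diagram bound (Thm 1.3) and the sliding-scale
infrared bound (Thm 5.6), the exponential-moment estimate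
`aizenmanDuminilCopin_mgf_normalizedField_bound_abs` (`d = 4`, `β ≤ β_c`, `1 < L ≤ ξ(β)`) holds:
Aizenman's Prop. 12.1 is a theorem of the tree (`aizenman_wickDeviation_le_finite_holds`), the
`d = 4` bound `Σ_L⁻² ∑ |U₄| ≤ C r¹² (log L)^{-c}` is the §6.3 summation
(`aizenmanDuminilCopin_ursellFourSum_le_of_facts`), and the Gibbs state is unique up to `β_c`
(`hasUniqueGibbsMeasure_of_lt_criticalBeta_holds`, `hasUniqueGibbsMeasure_criticalBeta_holds`).
[cite: AizenmanDuminilCopinAnnals2021, arXiv:1912.07973 Prop. 1.4 (p. 6), proof §6.3 (pp. 26–27), Thm 1.3 (p. 6), Thm 5.6 (p. 18)] -/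
theorem aizenmanDuminilCopin_mgf_normalizedField_bound_abs_of_adc
    (h13 : aizenmanDuminilCopin_improvedTreeDiagramBound)
    (h56 : aizenmanDuminilCopin_slidingScaleInfraredBound) :
    aizenmanDuminilCopin_mgf_normalizedField_bound_abs :=
  aizenmanDuminilCopin_mgf_normalizedField_bound_abs_of_wickDeviation
    aizenman_wickDeviation_le_finite_holds
    (aizenmanDuminilCopin_ursellFourSum_le_of_facts h13 h56)
    (fun {_} {_} => hasUniqueGibbsMeasure_of_lt_criticalBeta_holds)
    (fun {_} => hasUniqueGibbsMeasure_criticalBeta_holds)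

universe u in
/-- **crit-ising.S13 in the printed regime from Aizenman–Duminil-Copin's Theorems 1.3 and 5.6.**
The Gaussianity of every scaling limit in law of the rescaled nearest-neighbour Ising spin field on
`ℤ^d`, `d ≥ 4`, in the regime covered by print (`d = 4`: `β_k = β_c` or `L_k = O(ξ(β_k))`, ADC 2021,
Thm 1.2 via Prop. 1.4 and p. 6; `d ≥ 5`: `β_k ≥ β₀ > 0`, Panis 2023, Thm 5.5 — here a theorem,
`panis_mgf_normalizedField_bound_holds`), follows from the improved tree diagram bound (ADC Thm 1.3,
`aizenmanDuminilCopin_improvedTreeDiagramBound`) and the sliding-scale infrared bound (ADC Thm 5.6,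
`aizenmanDuminilCopin_slidingScaleInfraredBound`) alone: the `d = 4` exponential-moment estimate is
`aizenmanDuminilCopin_mgf_normalizedField_bound_abs_of_adc`, the variance bounds are
`normalizedField_variance_bounds_holds`, and the probabilistic assembly is
`isGaussianProcess_of_tendstoInDistribution_smearedSpin_printRegime_of_bounds'`
(`HighDimTrivialityMoments`, Part E). These two theorems of ADC 2021 are the entire remaining trust
base of crit-ising.S13 (printed regime).
[cite: AizenmanDuminilCopinAnnals2021, arXiv:1912.07973 Thm 1.2 and p. 6 (Gaussianity), Prop. 1.4, Thm 1.3 (p. 6), Thm 5.6 (p. 18), §6.3 (pp. 26–27)] [cite: Panis2023Triviality, Thm. 5.5 (d ≥ 5)] -/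
theorem isGaussianProcess_of_tendstoInDistribution_smearedSpin_printRegime_of_adc
    (h13 : aizenmanDuminilCopin_improvedTreeDiagramBound)
    (h56 : aizenmanDuminilCopin_slidingScaleInfraredBound) :
    isGaussianProcess_of_tendstoInDistribution_smearedSpin_printRegime.{u} :=
  isGaussianProcess_of_tendstoInDistribution_smearedSpin_printRegime_of_bounds'
    (aizenmanDuminilCopin_mgf_normalizedField_bound_abs_of_adc h13 h56)
    normalizedField_variance_bounds_holds
    panis_mgf_normalizedField_bound_holds

universe u in
/-- **crit-ising.S13 in the printed regime from Aizenman–Duminil-Copin's Theorem 1.3 alone.** The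
Gaussianity of every scaling limit in law of the rescaled nearest-neighbour Ising spin field on `ℤ^d`,
`d ≥ 4`, in the regime covered by print (`isGaussianProcess_of_tendstoInDistribution_smearedSpin_printRegime`:
`d = 4`, `β_k = β_c` or `L_k = O(ξ(β_k))` — ADC 2021, Thm 1.2 via Prop. 1.4 and the argument on p. 6;
`d ≥ 5`, `β_k ≥ β₀ > 0` — Panis 2023, Thm 5.5, a theorem of the tree) follows from the improved tree
diagram bound `aizenmanDuminilCopin_improvedTreeDiagramBound` (ADC Thm 1.3) and nothing else: the
second input of `isGaussianProcess_of_tendstoInDistribution_smearedSpin_printRegime_of_adc`, the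
sliding-scale infrared bound (ADC Thm 5.6), is the tree's theorem
`aizenmanDuminilCopin_slidingScaleInfraredBound_holds`. This single theorem of ADC 2021 is the entire
remaining trust base of crit-ising.S13 (printed regime).
[cite: AizenmanDuminilCopinAnnals2021, arXiv:1912.07973 Thm 1.2 and p. 6 (Gaussianity), Prop. 1.4, Thm 1.3 (p. 6), Thm 5.6 (p. 18), §6.3 (pp. 26–27)] [cite: Panis2023Triviality, Thm. 5.5 (d ≥ 5)] -/
theorem isGaussianProcess_of_tendstoInDistribution_smearedSpin_printRegime_of_improvedTreeDiagramBound
    (h13 : aizenmanDuminilCopin_improvedTreeDiagramBound) :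
    isGaussianProcess_of_tendstoInDistribution_smearedSpin_printRegime.{u} :=
  isGaussianProcess_of_tendstoInDistribution_smearedSpin_printRegime_of_adc h13
    aizenmanDuminilCopin_slidingScaleInfraredBound_holds

/-- **Aizenman–Duminil-Copin 2021, Prop. 1.4 (in the form its proof establishes) from Theorem 1.3
alone.** The exponential-moment estimate `aizenmanDuminilCopin_mgf_normalizedField_bound_abs` — for the
nearest-neighbour Ising model on `ℤ⁴`, `β ≤ β_c`, `1 < L ≤ ξ(β)`, `f ∈ C_0(ℝ⁴)` vanishing outside
`[-r,r]⁴`, `|⟨e^{zT_{f,L}}⟩ - e^{z²⟨T_{f,L}²⟩/2}| ≤ e^{z²⟨T_{|f|,L}²⟩/2} · C ‖f‖_∞⁴ r¹² z⁴ (log L)^{-c}`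
(arXiv:1912.07973, Prop. 1.4, p. 6; proof §6.3, p. 26: the inequality of [Aiz82], "Combined with the
improved tree diagram bound", the summation "Multiplying by `z^{2n}/(2n)!` and summing over `n`", and
"`S(L,r,β) ≤ C₂ r¹² (log log L / log L)^c`") — follows from the improved tree diagram bound
`aizenmanDuminilCopin_improvedTreeDiagramBound` (ADC Thm 1.3) and no other unproved input: the second
hypothesis of `aizenmanDuminilCopin_mgf_normalizedField_bound_abs_of_adc`, the sliding-scale infrared
bound (ADC Thm 5.6), is the tree's theorem `aizenmanDuminilCopin_slidingScaleInfraredBound_holds`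
(`SlidingScaleInfraredBoundProofs`), while Aizenman's Prop. 12.1 (`aizenman_wickDeviation_le_finite_holds`),
the §6.3 summation (`aizenmanDuminilCopin_ursellFourSum_le_of_facts`) and uniqueness of the Gibbs state up
to and at `β_c` (`hasUniqueGibbsMeasure_of_lt_criticalBeta_holds`, `hasUniqueGibbsMeasure_criticalBeta_holds`)
were already theorems. The discharge `aizenmanDuminilCopin_mgf_normalizedField_bound_abs_holds` is this
theorem applied to `aizenmanDuminilCopin_improvedTreeDiagramBound_holds` once Theorem 1.3 is proved.
[cite: AizenmanDuminilCopinAnnals2021, arXiv:1912.07973 Prop. 1.4 (p. 6), proof §6.3 (p. 26), Thm 1.3 (p. 6), Thm 5.6 (p. 18)] -/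
theorem aizenmanDuminilCopin_mgf_normalizedField_bound_abs_of_improvedTreeDiagramBound
    (h13 : aizenmanDuminilCopin_improvedTreeDiagramBound) :
    aizenmanDuminilCopin_mgf_normalizedField_bound_abs :=
  aizenmanDuminilCopin_mgf_normalizedField_bound_abs_of_adc h13
    aizenmanDuminilCopin_slidingScaleInfraredBound_holds

end Literature.Probability.LatticeModels

end
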